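import Literature.NumberTheory.LFunctions.ChebyshevHalfLineBiasCharExplicitFormula
import Literature.NumberTheory.LFunctions.ChebyshevHalfLineBiasCharacters
import Literature.NumberTheory.LFunctions.MertensConstant
import Literature.NumberTheory.LFunctions.GeneralizedRH
import Mathlib.NumberTheory.AbelSummation
import Mathlib.NumberTheory.LSeries.Dirichlet
import HarnessLib

/-!
# GRH-CONDITIONAL asymptotics inside a GRH-EQUIVALENT criterion (Suzuki 2025, Thm 9 second half, (4.8)), PROVED — «nothing here bears on the truth of RH»
# `Σ_{p ≤ x} χ(p) log p √(x/p) log(x/p) = −(√x/4) log²x + O(√x log x)` under GRH for `L(s, χ)`, `χ` real non-principal, `L(½, χ) ≠ 0`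

LINE 1 — LABEL: GRH-CONDITIONAL asymptotic formula (the «conversely» half of a GRH criterion), PROVED from the
tree's RH-FREE exact explicit formula for the half-line Riesz sum (`ChebyshevHalfLineBiasCharExplicitFormula.lean`)
and the tree's Mertens theorem (`MertensConstant.lean`). bears_on: LADDER-RH COLUMN 1 SCREW (S-C, criterion rung:
Suzuki's Thm 9 ⟸, whose case `χ = χ₄` is Thm 4 ⟹). WHAT THIS IS NOT: not a route, not progress toward RH or GRH —
under GRH it computes an asymptotic, and nothing here bears on the truth of RH.

M. Suzuki, *On variants of Chebyshev's conjecture*, Ramanujan J. **68** (2025), no. 4, art. 95 = arXiv:2411.07436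
[`Suzuki2025Chebyshev`; PUBLISHED, refereed], §4.2 **Theorem 9, second half**, AS PRINTED: «Conversely, suppose that
the GRH for `L(s, χ)` holds and `L(1/2, χ) ≠ 0`. Then, the asymptotic formula
`Σ_{p ≤ x} χ(p) log p · √(x/p) log(x/p) = −(√x/4)(log x)² (1 + O(1/log x))` (4.8) holds as `x → ∞`. Therefore, (4.7)
is valid for all sufficiently large `x > 1`, and the left-hand side of (4.7) tends to `−∞` as `x → ∞`.» — the named
fact `Suzuki2025Chebyshev_thm9_asymp` of `ChebyshevHalfLineBiasCharacters.lean` (typed for every real non-principal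
`χ` mod `q`, (4.8) as `Σ_{p ≤ x} … + (√x/4)(log x)² = O(√x log x)`), DISCHARGED here:
`Suzuki2025Chebyshev_thm9_asymp_holds`.

## The printed proof (§4.2, p. 12) and this formalisation

«Let `f_χ(x)` be the function in (4.3) [`= Σ_{n ≤ x} Λ(n)χ(n) n^{-1/2} log(x/n)`]. If we define
`f₁(x) := Σ_{p ≤ x} χ(p) log p/√p · log(x/p)`, `f₂(x) := Σ_{p ≤ √x} χ(p)² log p/p · log(x/p²)`,
`f₃(x) := Σ_{k ≥ 3} Σ_{p ≤ x^{1/k}} χ(p)^k log p/p^{k/2} · log(x/p^k)`, then `f_χ = f₁ + f₂ + f₃`. For `f₂(x)`, we have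
`f₂(x) = log x Σ_{p ≤ √x} log p/p − 2 Σ_{p ≤ √x} (log p)²/p + O(log x) = … = ¼ (log x)² + O(log x)` [by Mertens, (2.1)];
`f₃(x) ≪ log x`; and under GRH `f_χ(x) = −(L'/L)(½) log x + O(1)` by (4.5). Hence
`f₁(x) = −¼(log x)² + O(log x)`, which is (4.8) after multiplication by `√x`.» This file follows that road:

* §1 `fSum_eq`: the split `f = f₁ + f₂ + f₃` of `Σ_{n ≤ x} Λ(n) a(n) n^{-1/2} log(x/n)` for any real coefficients `a`
  (partition of the prime powers `≤ x` into primes, squares of primes, and `p^k`, `k ≥ 3`);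
* §2 `abs_fThree_le`: `|f₃(x)| ≤ 4 (Σ_n Λ(n) n^{-3/2}) log x` (`|a| ≤ 1`; the `k`-sum is geometric, and
  `Σ_p log p · p^{-3/2} ≤ Σ_n Λ(n) n^{-3/2} < ∞` is Mathlib's `LSeriesSummable_vonMangoldt` at `s = 3/2`);
* §3 `sum_log_div_mul_log_eq` / `abs_fTwo_sub_le`: ONE Abel summation (Mathlib `sum_mul_eq_sub_sub_integral_mul`)
  against the tree's Mertens theorem with explicit constant `|Σ_{p ≤ t} log p/p − log t| ≤ 4` (`t ≥ 1`,
  `Mertens.abs_mertensTau_le`) gives `Σ_{p ≤ y} (log p/p) log(y/p) = ½ log²y + ∫₁^y τ(t) dt/t`, `|∫| ≤ 4 log y` — the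
  weight `log(y/p)` vanishes at `p = y`, so there is no boundary term — whence, at `y = √x` and after removing the
  finitely many `p ∣ N` (where `a(p²) = 0`), `|f₂(x) − ¼ log²x| ≤ (4 + 2Σ_{p ∣ N} log p/p) log x`;
* §4 `exists_abs_fSum_le`: for a PRIMITIVE `ψ` mod `N > 1` with `L(½, ψ) ≠ 0` under GRH, `|f_ψ(x)| ≤ B + ‖(L'/L)(½, ψ)‖ log x`
  (`x > 1`) — the real part of the tree's `HalfLineRiesz.exists_norm_halfLineSum_add_le_of_GRH` (Suzuki (4.5));
* §5 `exists_abs_primeSum_add_le`: the printed conclusion for primitive real `ψ`;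
* §6 `Suzuki2025Chebyshev_thm9_asymp_holds`: a real non-principal `χ` mod `q` is induced by the primitive real
  `ψ = χ⋆` mod `N = conductor > 1` (Mathlib `changeLevel_primitiveCharacter`); GRH and `L(½) ≠ 0` transfer
  (the tree's `riemannHypothesis_iff_primitiveCharacter_holds`, `LFunction_eq_zero_iff_primitiveCharacter`), and
  `f₁` for `χ` and for `ψ` differ only at the primes `p ∣ q`, by at most `(Σ_{p ∣ q} log p) log x`.
  (The printed text states Thm 9 for «a real Dirichlet character»; the passage to the inducing primitive character,
  implicit in the paper's use of (4.5) «for `L(s, χ*)`», is the only step spelled out here that the paper leaves tacit.)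

GRH-CONDITIONAL asymptotic; nothing in this file is, or is worded as, progress toward RH or GRH. Theorems only
(D-0014/D-0026): no named facts; the definitions are glue (`fSum`, `fOne`, `fTwo`, `fThree`, `higherPow`, `w`).

## References
* [Suzuki2025Chebyshev] M. Suzuki, Ramanujan J. 68 (2025) 95 = arXiv:2411.07436: §4.2 Thm 9 (second half), (4.8),
  proof p. 12 (`f_χ = f₁ + f₂ + f₃`, (2.1)).
* [HardyWright2008] G. H. Hardy, E. M. Wright, *An Introduction to the Theory of Numbers*, 6th ed., Thm 425 and
  §22.7 (22.7.3) (Mertens: `Σ_{p ≤ x} log p/p = log x + O(1)`) — the tree's `MertensConstant.lean`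
  (`Mertens.abs_mertensTau_le`, explicit constant 4).
* [MontgomeryVaughan2007] H. L. Montgomery, R. C. Vaughan, *Multiplicative Number Theory I*, Thm 2.7 (b) (the same).
-/

noncomputable section

open Filter Topology Set MeasureTheory ArithmeticFunction Asymptotics
open scoped Real

namespace Literature.NumberTheory.LFunctions

namespace SuzukiThm9

/-! ## §1 The sums `f`, `f₁`, `f₂`, `f₃` and the split `f = f₁ + f₂ + f₃` -/

/-- `f(x) = Σ_{n ≤ x} Λ(n) a(n) n^{-1/2} log(x/n)` for real coefficients `a` (Suzuki's `f_χ` of (4.3) is the case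
`a = χ`, `χ` real; for complex `χ` its real part is the case `a = Re χ`). [cite: Suzuki2025Chebyshev, §4.1 (4.3)] -/
def fSum (a : ℕ → ℝ) (x : ℝ) : ℝ :=
  ∑ n ∈ Finset.Icc 1 ⌊x⌋₊, Λ n * a n / Real.sqrt n * Real.log (x / n)

/-- `f₁(x) = Σ_{p ≤ x} a(p) log p/√p · log(x/p)` (the primes). [cite: Suzuki2025Chebyshev, §4.2 (proof of Thm 9)] -/
def fOne (a : ℕ → ℝ) (x : ℝ) : ℝ :=
  ∑ p ∈ (Finset.Icc 1 ⌊x⌋₊).filter Nat.Prime, a p * Real.log p / Real.sqrt p * Real.log (x / p)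

/-- `f₂(x) = Σ_{p ≤ √x} a(p²) log p/p · log(x/p²)` (the squares of primes).
[cite: Suzuki2025Chebyshev, §4.2 (proof of Thm 9)] -/
def fTwo (a : ℕ → ℝ) (x : ℝ) : ℝ :=
  ∑ p ∈ (Finset.Icc 1 ⌊Real.sqrt x⌋₊).filter Nat.Prime,
    a (p ^ 2) * Real.log p / p * Real.log (x / (p : ℝ) ^ 2)

/-- The prime powers `p^k ≤ X` with `k ≥ 3`, listed as the prime powers `≤ X` that are neither primes nor squares
of primes (`exists_eq_pow_of_mem_higherPow`). [folklore] -/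
def higherPow (X : ℕ) : Finset ℕ :=
  (Finset.Icc 1 X).filter fun n ↦
    IsPrimePow n ∧ ¬ n.Prime ∧ ¬ (Nat.sqrt n * Nat.sqrt n = n ∧ (Nat.sqrt n).Prime)

/-- `f₃(x) = Σ_{k ≥ 3} Σ_{p^k ≤ x} a(p^k) log p/p^{k/2} · log(x/p^k)` (the higher prime powers).
[cite: Suzuki2025Chebyshev, §4.2 (proof of Thm 9)] -/
def fThree (a : ℕ → ℝ) (x : ℝ) : ℝ :=
  ∑ n ∈ higherPow ⌊x⌋₊, Λ n * a n / Real.sqrt n * Real.log (x / n)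

/-- The prime powers `≤ x` that are squares of primes are exactly the `p²`, `p ≤ √x` prime. [folklore] -/
private theorem filter_sq_eq {x : ℝ} (hx : 0 ≤ x) :
    ((Finset.Icc 1 ⌊x⌋₊).filter fun n ↦ IsPrimePow n ∧ ¬ n.Prime ∧
        (Nat.sqrt n * Nat.sqrt n = n ∧ (Nat.sqrt n).Prime)) =
      ((Finset.Icc 1 ⌊Real.sqrt x⌋₊).filter Nat.Prime).image fun p ↦ p ^ 2 := by
  ext n
  simp only [Finset.mem_filter, Finset.mem_Icc, Finset.mem_image]
  constructor
  · rintro ⟨⟨-, hX⟩, -, -, hsq, hp⟩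
    refine ⟨Nat.sqrt n, ⟨⟨hp.one_lt.le, ?_⟩, hp⟩, by rw [sq, hsq]⟩
    apply Nat.le_floor
    have h1 : ((Nat.sqrt n : ℕ) : ℝ) ^ 2 ≤ x := by
      have h2 : ((Nat.sqrt n * Nat.sqrt n : ℕ) : ℝ) ≤ x := by
        rw [hsq]; exact le_trans (by exact_mod_cast hX) (Nat.floor_le hx)
      push_cast at h2
      nlinarith [h2]
    exact (Real.le_sqrt (Nat.cast_nonneg _) hx).2 h1
  · rintro ⟨p, ⟨⟨-, hpy⟩, hp⟩, rfl⟩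
    have hp2 : p ^ 2 ≤ ⌊x⌋₊ := by
      apply Nat.le_floor
      push_cast
      have h1 : (p : ℝ) ≤ Real.sqrt x := le_trans (by exact_mod_cast hpy) (Nat.floor_le (Real.sqrt_nonneg x))
      have h0 : (0 : ℝ) ≤ p := Nat.cast_nonneg _
      nlinarith [Real.sq_sqrt hx, Real.sqrt_nonneg x]
    refine ⟨⟨Nat.one_le_pow _ _ hp.pos, hp2⟩, hp.isPrimePow.pow two_ne_zero, ?_, ?_, ?_⟩
    · rw [sq]; exact Nat.not_prime_mul hp.one_lt.ne' hp.one_lt.ne'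
    · rw [Nat.sqrt_eq', sq]
    · rw [Nat.sqrt_eq']; exact hp

/-- **`f = f₁ + f₂ + f₃`** (partition of the prime powers `≤ x` by the exponent; `Λ` vanishes off prime powers).
[cite: Suzuki2025Chebyshev, §4.2 (proof of Thm 9)] -/
theorem fSum_eq (a : ℕ → ℝ) {x : ℝ} (hx : 0 ≤ x) : fSum a x = fOne a x + fTwo a x + fThree a x := by
  set g : ℕ → ℝ := fun n ↦ Λ n * a n / Real.sqrt n * Real.log (x / n) with hg
  set T := (Finset.Icc 1 ⌊x⌋₊).filter IsPrimePow with hT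
  have hS : fSum a x = ∑ n ∈ T, g n := by
    rw [hT, Finset.sum_filter_of_ne]
    · rfl
    · intro n _ hne
      by_contra h
      apply hne
      rw [hg]
      simp only [vonMangoldt_eq_zero_iff.2 h, zero_mul, zero_div]
  have h1 : T.filter Nat.Prime = (Finset.Icc 1 ⌊x⌋₊).filter Nat.Prime := by
    rw [hT, Finset.filter_filter]
    exact Finset.filter_congr fun n _ ↦ ⟨fun h ↦ h.2, fun h ↦ ⟨h.isPrimePow, h⟩⟩
  have h2 : (T.filter fun n ↦ ¬ n.Prime).filter
      (fun n ↦ Nat.sqrt n * Nat.sqrt n = n ∧ (Nat.sqrt n).Prime) =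
      ((Finset.Icc 1 ⌊Real.sqrt x⌋₊).filter Nat.Prime).image fun p ↦ p ^ 2 := by
    rw [hT, Finset.filter_filter, Finset.filter_filter, ← filter_sq_eq hx]
  have h3 : (T.filter fun n ↦ ¬ n.Prime).filter
      (fun n ↦ ¬ (Nat.sqrt n * Nat.sqrt n = n ∧ (Nat.sqrt n).Prime)) = higherPow ⌊x⌋₊ := by
    rw [hT, higherPow, Finset.filter_filter, Finset.filter_filter]
  have e1 : ∑ p ∈ (Finset.Icc 1 ⌊x⌋₊).filter Nat.Prime, g p = fOne a x := by
    refine Finset.sum_congr rfl fun p hp ↦ ?_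
    rw [Finset.mem_filter] at hp
    simp only [hg, vonMangoldt_apply_prime hp.2]
    ring
  have e2 : ∑ p ∈ (Finset.Icc 1 ⌊Real.sqrt x⌋₊).filter Nat.Prime, g (p ^ 2) = fTwo a x := by
    refine Finset.sum_congr rfl fun p hp ↦ ?_
    rw [Finset.mem_filter] at hp
    have hp0 : (0 : ℝ) ≤ p := Nat.cast_nonneg _
    simp only [hg, vonMangoldt_apply_pow two_ne_zero, vonMangoldt_apply_prime hp.2, Nat.cast_pow,
      Real.sqrt_sq hp0]
    ring
  rw [hS, ← Finset.sum_filter_add_sum_filter_not T Nat.Prime,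
    ← Finset.sum_filter_add_sum_filter_not (T.filter fun n ↦ ¬ n.Prime)
      (fun n ↦ Nat.sqrt n * Nat.sqrt n = n ∧ (Nat.sqrt n).Prime),
    h1, h2, h3, Finset.sum_image fun p _ p' _ h ↦ Nat.pow_left_injective two_ne_zero h, e1, e2, add_assoc]
  rfl

/-! ## §2 `f₃ = O(log x)`: the higher prime powers -/

/-- The summable majorant `w(n) = Λ(n) n^{-3/2}`. [folklore] -/
def w (n : ℕ) : ℝ := Λ n / (n : ℝ) ^ (3 / 2 : ℝ)

/-- `0 ≤ w(n)`. [folklore] -/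
private theorem w_nonneg (n : ℕ) : 0 ≤ w n :=
  div_nonneg vonMangoldt_nonneg (Real.rpow_nonneg (Nat.cast_nonneg _) _)

/-- `Σ_n Λ(n) n^{-3/2} < ∞` (Mathlib: the `L`-series of `Λ` converges absolutely for `Re s > 1`). [folklore] -/
private theorem summable_w : Summable w := by
  have h := (ArithmeticFunction.LSeriesSummable_vonMangoldt (s := ((3 / 2 : ℝ) : ℂ))
    (by rw [Complex.ofReal_re]; norm_num)).norm
  refine h.congr fun n ↦ ?_
  rw [LSeries.norm_term_eq]
  rcases eq_or_ne n 0 with rfl | hn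
  · simp [w]
  · rw [if_neg hn, Complex.ofReal_re, Complex.norm_real, Real.norm_eq_abs,
      abs_of_nonneg vonMangoldt_nonneg, w]

/-- Every element of `higherPow X` is `p^k` with `p` prime and `k ≥ 3`. [folklore] -/
private theorem exists_eq_pow_of_mem_higherPow {X n : ℕ} (hn : n ∈ higherPow X) :
    ∃ p k : ℕ, p.Prime ∧ 3 ≤ k ∧ p ^ k = n := by
  simp only [higherPow, Finset.mem_filter] at hn
  obtain ⟨-, hpp, hnp, hsq⟩ := hn
  obtain ⟨p, k, hp, hk, rfl⟩ := (isPrimePow_nat_iff _).1 hpp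
  refine ⟨p, k, hp, ?_, rfl⟩
  by_contra hk3
  interval_cases k
  · exact hnp (by simpa using hp)
  · exact hsq ⟨by rw [Nat.sqrt_eq', sq], by rw [Nat.sqrt_eq']; exact hp⟩

/-- `higherPow X ⊆ {p^k : p ≤ X prime, 3 ≤ k ≤ X}`. [folklore] -/
private theorem higherPow_subset_image (X : ℕ) :
    higherPow X ⊆ (((Finset.Icc 1 X).filter Nat.Prime) ×ˢ Finset.Ico 3 (X + 1)).image
      fun pk : ℕ × ℕ ↦ pk.1 ^ pk.2 := by
  intro n hn
  obtain ⟨p, k, hp, hk, rfl⟩ := exists_eq_pow_of_mem_higherPow hn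
  have hnX : p ^ k ≤ X := by
    simp only [higherPow, Finset.mem_filter, Finset.mem_Icc] at hn
    exact hn.1.2
  simp only [Finset.mem_image, Finset.mem_product, Finset.mem_filter, Finset.mem_Icc, Finset.mem_Ico]
  refine ⟨(p, k), ⟨⟨⟨hp.pos, le_trans (Nat.le_self_pow (by omega) p) hnX⟩, hp⟩, hk, ?_⟩, rfl⟩
  have h2 : 2 ^ k ≤ X := le_trans (Nat.pow_le_pow_left hp.two_le k) hnX
  have h3 : k < 2 ^ k := Nat.lt_two_pow_self
  omega

/-- `√(y^k) = (√y)^k` for `y ≥ 0`. [folklore] -/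
private theorem sqrt_pow_eq {y : ℝ} (hy : 0 ≤ y) (k : ℕ) : Real.sqrt (y ^ k) = Real.sqrt y ^ k := by
  rw [show y ^ k = (Real.sqrt y ^ k) ^ 2 by rw [← pow_mul, mul_comm, pow_mul, Real.sq_sqrt hy],
    Real.sqrt_sq (pow_nonneg (Real.sqrt_nonneg _) _)]

/-- `Λ(p^k)/√(p^k) = log p · (1/√p)^k`. [folklore] -/
private theorem term_pow_eq {p : ℕ} (hp : p.Prime) {k : ℕ} (hk : k ≠ 0) :
    Λ (p ^ k) / Real.sqrt ((p ^ k : ℕ) : ℝ) = Real.log p * (Real.sqrt p)⁻¹ ^ k := by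
  rw [vonMangoldt_apply_pow hk, vonMangoldt_apply_prime hp, Nat.cast_pow,
    sqrt_pow_eq (Nat.cast_nonneg _), inv_pow, div_eq_mul_inv]

/-- The geometric `k`-sum: `Σ_{3 ≤ k ≤ X} r^k ≤ 4 r³` for `0 ≤ r ≤ 3/4`. [folklore] -/
private theorem geom_bound {r : ℝ} (hr0 : 0 ≤ r) (hr : r ≤ 3 / 4) (X : ℕ) :
    ∑ k ∈ Finset.Ico 3 (X + 1), r ^ k ≤ 4 * r ^ 3 := by
  calc ∑ k ∈ Finset.Ico 3 (X + 1), r ^ k ≤ r ^ 3 / (1 - r) := geom_sum_Ico_le_of_lt_one hr0 (by linarith)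
    _ ≤ 4 * r ^ 3 := by
        rw [div_le_iff₀ (by linarith)]
        have h3 : 0 ≤ r ^ 3 := pow_nonneg hr0 3
        nlinarith [mul_nonneg h3 (by linarith : (0 : ℝ) ≤ 3 - 4 * r)]

/-- **`Σ_{p^k ≤ X, k ≥ 3} Λ(p^k)/√(p^k) ≤ 4 Σ_n Λ(n) n^{-3/2}`**, uniformly in `X` (the convergent double sum behind
«`f₃(x) ≪ log x`»). [cite: Suzuki2025Chebyshev, §4.2 (proof of Thm 9, `f₃`)] -/
theorem sum_higherPow_le (X : ℕ) : ∑ n ∈ higherPow X, Λ n / Real.sqrt n ≤ 4 * ∑' n, w n := by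
  have hv0 : ∀ n : ℕ, 0 ≤ Λ n / Real.sqrt n := fun n ↦ div_nonneg vonMangoldt_nonneg (Real.sqrt_nonneg _)
  calc ∑ n ∈ higherPow X, Λ n / Real.sqrt n
      ≤ ∑ n ∈ (((Finset.Icc 1 X).filter Nat.Prime) ×ˢ Finset.Ico 3 (X + 1)).image
          (fun pk : ℕ × ℕ ↦ pk.1 ^ pk.2), Λ n / Real.sqrt n :=
        Finset.sum_le_sum_of_subset_of_nonneg (higherPow_subset_image X) fun n _ _ ↦ hv0 n
    _ ≤ ∑ pk ∈ ((Finset.Icc 1 X).filter Nat.Prime) ×ˢ Finset.Ico 3 (X + 1),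
          Λ (pk.1 ^ pk.2) / Real.sqrt ((pk.1 ^ pk.2 : ℕ) : ℝ) :=
        Finset.sum_image_le_of_nonneg fun n _ ↦ hv0 n
    _ = ∑ p ∈ (Finset.Icc 1 X).filter Nat.Prime, ∑ k ∈ Finset.Ico 3 (X + 1),
          Λ (p ^ k) / Real.sqrt ((p ^ k : ℕ) : ℝ) := Finset.sum_product _ _ _
    _ ≤ ∑ p ∈ (Finset.Icc 1 X).filter Nat.Prime, 4 * w p := by
        refine Finset.sum_le_sum fun p hp ↦ ?_
        rw [Finset.mem_filter] at hp
        have hpr := hp.2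
        have hp0 : (0 : ℝ) < p := by exact_mod_cast hpr.pos
        have hlog : 0 ≤ Real.log p := Real.log_nonneg (by exact_mod_cast hpr.one_lt.le)
        set r : ℝ := (Real.sqrt p)⁻¹ with hr
        have hr0 : 0 ≤ r := inv_nonneg.2 (Real.sqrt_nonneg _)
        have hr34 : r ≤ 3 / 4 := by
          have h43 : (4 / 3 : ℝ) ≤ Real.sqrt p := by
            rw [Real.le_sqrt (by norm_num) hp0.le]
            have h2 : (2 : ℝ) ≤ p := by exact_mod_cast hpr.two_le
            nlinarith
          calc r = (Real.sqrt p)⁻¹ := hr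
            _ ≤ (4 / 3 : ℝ)⁻¹ := inv_anti₀ (by norm_num) h43
            _ = 3 / 4 := by norm_num
        calc ∑ k ∈ Finset.Ico 3 (X + 1), Λ (p ^ k) / Real.sqrt ((p ^ k : ℕ) : ℝ)
            = ∑ k ∈ Finset.Ico 3 (X + 1), Real.log p * r ^ k := by
              refine Finset.sum_congr rfl fun k hk ↦ ?_
              rw [Finset.mem_Ico] at hk
              rw [term_pow_eq hpr (by omega)]
          _ = Real.log p * ∑ k ∈ Finset.Ico 3 (X + 1), r ^ k := by rw [Finset.mul_sum]
          _ ≤ Real.log p * (4 * r ^ 3) := mul_le_mul_of_nonneg_left (geom_bound hr0 hr34 X) hlog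
          _ = 4 * w p := by
              rw [hr, w, inv_pow, vonMangoldt_apply_prime hpr,
                show Real.sqrt (p : ℝ) ^ 3 = (p : ℝ) ^ (3 / 2 : ℝ) by
                  rw [Real.sqrt_eq_rpow, ← Real.rpow_natCast, ← Real.rpow_mul hp0.le]; norm_num]
              ring
    _ = 4 * ∑ p ∈ (Finset.Icc 1 X).filter Nat.Prime, w p := by rw [Finset.mul_sum]
    _ ≤ 4 * ∑' n, w n := by
        gcongr
        exact summable_w.sum_le_tsum _ fun n _ ↦ w_nonneg n

/-- **`|f₃(x)| ≤ 4 (Σ_n Λ(n) n^{-3/2}) · log x`** for `x ≥ 1` and `|a| ≤ 1` («`f₃(x) ≪ log x`»).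
[cite: Suzuki2025Chebyshev, §4.2 (proof of Thm 9)] -/
theorem abs_fThree_le {a : ℕ → ℝ} (ha : ∀ n, |a n| ≤ 1) {x : ℝ} (hx : 1 ≤ x) :
    |fThree a x| ≤ 4 * (∑' n, w n) * Real.log x := by
  have hlx : 0 ≤ Real.log x := Real.log_nonneg hx
  calc |fThree a x| ≤ ∑ n ∈ higherPow ⌊x⌋₊, |Λ n * a n / Real.sqrt n * Real.log (x / n)| :=
        Finset.abs_sum_le_sum_abs _ _
    _ ≤ ∑ n ∈ higherPow ⌊x⌋₊, Λ n / Real.sqrt n * Real.log x := by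
        refine Finset.sum_le_sum fun n hn ↦ ?_
        have hn' : n ∈ Finset.Icc 1 ⌊x⌋₊ := (Finset.mem_filter.1 hn).1
        rw [Finset.mem_Icc] at hn'
        have hn0 : (0 : ℝ) < n := by exact_mod_cast hn'.1
        have hnx : (n : ℝ) ≤ x := le_trans (by exact_mod_cast hn'.2) (Nat.floor_le (by linarith))
        have hlog0 : 0 ≤ Real.log (x / n) := Real.log_nonneg ((one_le_div hn0).2 hnx)
        have hlogle : Real.log (x / n) ≤ Real.log x :=
          Real.log_le_log (div_pos (by linarith) hn0) (div_le_self (by linarith) (by exact_mod_cast hn'.1))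
        rw [abs_mul, abs_div, abs_mul, abs_of_nonneg vonMangoldt_nonneg,
          abs_of_nonneg (Real.sqrt_nonneg _), abs_of_nonneg hlog0]
        have h1 : Λ n * |a n| / Real.sqrt n ≤ Λ n / Real.sqrt n := by
          apply div_le_div_of_nonneg_right _ (Real.sqrt_nonneg _)
          calc Λ n * |a n| ≤ Λ n * 1 := mul_le_mul_of_nonneg_left (ha n) vonMangoldt_nonneg
            _ = Λ n := mul_one _
        exact mul_le_mul h1 hlogle hlog0 (div_nonneg vonMangoldt_nonneg (Real.sqrt_nonneg _))
    _ = (∑ n ∈ higherPow ⌊x⌋₊, Λ n / Real.sqrt n) * Real.log x := by rw [Finset.sum_mul]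
    _ ≤ 4 * (∑' n, w n) * Real.log x :=
        mul_le_mul_of_nonneg_right (sum_higherPow_le _) hlx

/-! ## §3 `f₂ = ¼ log²x + O(log x)`: Mertens' theorem and one Abel summation -/

/-- The Abel-summation counting function of `c(k) = 𝟙_{k prime} log k/k` is the tree's `Σ_{p ≤ t} log p/p`.
[folklore] -/
private theorem sum_Icc_indicator_eq (t : ℝ) :
    ∑ k ∈ Finset.Icc 0 ⌊t⌋₊, (if k.Prime then Real.log k / k else 0) = Mertens.primeLogDivSum t := by
  rw [Mertens.primeLogDivSum, ← Finset.sum_filter]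
  congr 1
  ext p
  simp [Nat.mem_primesLE, Finset.mem_filter]

/-- `Σ_{p ≤ 1} log p/p = 0`. [folklore] -/
private theorem primeLogDivSum_one : Mertens.primeLogDivSum 1 = 0 := by
  rw [Mertens.primeLogDivSum, Nat.floor_one, show Nat.primesLE 1 = ∅ by decide, Finset.sum_empty]

/-- `t ↦ τ(t)/t` is integrable on `(1, y]` (`τ` is measurable and `|τ| ≤ 4` there). [folklore] -/
private theorem intervalIntegrable_mertensTau_mul_inv {y : ℝ} (hy : 1 ≤ y) :
    IntervalIntegrable (fun t : ℝ ↦ Mertens.mertensTau t * t⁻¹) volume 1 y := by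
  rw [intervalIntegrable_iff_integrableOn_Ioc_of_le hy]
  refine Measure.integrableOn_of_bounded (M := 4) measure_Ioc_lt_top.ne
    ((Mertens.measurable_mertensTau.mul measurable_inv).aestronglyMeasurable) ?_
  refine ae_restrict_of_forall_mem measurableSet_Ioc fun t ht ↦ ?_
  have ht1 : 1 ≤ t := ht.1.le
  rw [norm_mul, Real.norm_eq_abs, Real.norm_eq_abs, abs_of_pos (inv_pos.2 (show (0 : ℝ) < t by linarith))]
  calc |Mertens.mertensTau t| * t⁻¹ ≤ 4 * 1 :=
        mul_le_mul (Mertens.abs_mertensTau_le ht1) (inv_le_one_of_one_le₀ ht1)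
          (inv_nonneg.2 (by linarith)) (by norm_num)
    _ = 4 := by norm_num

/-- **`|∫₁^y τ(t) dt/t| ≤ 4 log y`** for `y ≥ 1`, from Mertens' first theorem with the tree's explicit constant
`|τ(t)| = |Σ_{p ≤ t} log p/p − log t| ≤ 4` (`Mertens.abs_mertensTau_le`). [cite: HardyWright2008, Thm 425] -/
theorem abs_integral_mertensTau_le {y : ℝ} (hy : 1 ≤ y) :
    |∫ t in (1 : ℝ)..y, Mertens.mertensTau t * t⁻¹| ≤ 4 * Real.log y := by
  have h := intervalIntegral.norm_integral_le_of_norm_le (f := fun t : ℝ ↦ Mertens.mertensTau t * t⁻¹)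
    (g := fun t : ℝ ↦ 4 * t⁻¹) (μ := volume) hy
    (Eventually.of_forall fun t ht ↦ by
      have ht1 : 1 ≤ t := ht.1.le
      rw [norm_mul, Real.norm_eq_abs, Real.norm_eq_abs, abs_of_pos (inv_pos.2 (show (0 : ℝ) < t by linarith))]
      exact mul_le_mul_of_nonneg_right (Mertens.abs_mertensTau_le ht1) (inv_nonneg.2 (by linarith)))
    ((intervalIntegral.intervalIntegrable_inv (fun t ht ↦ by
        rw [uIcc_of_le hy] at ht; exact (by linarith [ht.1] : (t : ℝ) ≠ 0)) continuousOn_id).const_mul 4)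
  rw [Real.norm_eq_abs] at h
  refine le_trans h (le_of_eq ?_)
  rw [intervalIntegral.integral_const_mul, integral_inv_of_pos one_pos (by linarith), div_one]

/-- **Abel summation against Mertens' theorem**: for `y ≥ 1`,
`Σ_{p ≤ y} (log p/p) log(y/p) = ½ log²y + ∫₁^y τ(t) dt/t`, where `τ(t) = Σ_{p ≤ t} log p/p − log t`
(no boundary term: the weight `log(y/p)` vanishes at `p = y`); Mertens' first theorem `τ = O(1)` is Hardy–Wright
Thm 425 = Montgomery–Vaughan Thm 2.7 (b). [cite: HardyWright2008, Thm 425] -/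
theorem sum_log_div_mul_log_eq {y : ℝ} (hy : 1 ≤ y) :
    ∑ p ∈ (Finset.Icc 1 ⌊y⌋₊).filter Nat.Prime, Real.log p / p * Real.log (y / p) =
      Real.log y ^ 2 / 2 + ∫ t in (1 : ℝ)..y, Mertens.mertensTau t * t⁻¹ := by
  have hy0 : 0 < y := by linarith
  set f : ℝ → ℝ := fun t ↦ Real.log y - Real.log t with hf
  have hderiv : deriv f = fun t ↦ -t⁻¹ := by
    funext t
    rw [hf, deriv_const_sub, Real.deriv_log]
  have hdiff : ∀ t ∈ Set.Icc (1 : ℝ) y, DifferentiableAt ℝ f t := fun t ht ↦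
    (differentiableAt_const _).sub (Real.differentiableAt_log (by linarith [ht.1]))
  have hcont : ContinuousOn (fun t : ℝ ↦ -t⁻¹) (Set.Icc 1 y) :=
    (continuousOn_inv₀.mono fun t ht ↦ (by exact (by linarith [ht.1] : (t : ℝ) ≠ 0))).neg
  have hint : IntegrableOn (deriv f) (Set.Icc 1 y) := by
    rw [hderiv]; exact hcont.integrableOn_Icc
  have habel := sum_mul_eq_sub_sub_integral_mul (fun k ↦ if k.Prime then Real.log k / k else 0)
    zero_le_one hy hdiff hint
  simp only [sum_Icc_indicator_eq] at habel
  rw [Nat.floor_one, hderiv] at habel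
  have hf1 : f y = 0 := by simp [hf]
  rw [hf1, zero_mul, primeLogDivSum_one, mul_zero, sub_zero, zero_sub] at habel
  -- the left-hand side
  have hL : ∑ k ∈ Finset.Ioc 1 ⌊y⌋₊, f k * (if k.Prime then Real.log k / k else 0) =
      ∑ p ∈ (Finset.Icc 1 ⌊y⌋₊).filter Nat.Prime, Real.log p / p * Real.log (y / p) := by
    rw [Finset.sum_filter, Finset.Icc_eq_cons_Ioc (Nat.le_floor (by exact_mod_cast hy) : 1 ≤ ⌊y⌋₊),
      Finset.sum_cons]
    simp only [Nat.not_prime_one, if_false, zero_add]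
    refine Finset.sum_congr rfl fun k hk ↦ ?_
    by_cases hkp : k.Prime
    · have hk0 : (0 : ℝ) < k := by exact_mod_cast hkp.pos
      simp only [hf, hkp, if_true]
      rw [Real.log_div hy0.ne' hk0.ne']
      ring
    · simp [hkp]
  -- the right-hand side
  have hI1 : IntervalIntegrable (fun t : ℝ ↦ Real.log t * t⁻¹) volume 1 y := by
    apply ContinuousOn.intervalIntegrable
    rw [uIcc_of_le hy]
    exact ContinuousOn.mul (Real.continuousOn_log.mono fun t ht ↦ by
        simp only [mem_compl_iff, mem_singleton_iff]; linarith [ht.1])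
      (continuousOn_inv₀.mono fun t ht ↦ (by linarith [ht.1] : (t : ℝ) ≠ 0))
  have hI2 := intervalIntegrable_mertensTau_mul_inv hy
  have hR : -∫ t in Set.Ioc 1 y, -t⁻¹ * Mertens.primeLogDivSum t =
      Real.log y ^ 2 / 2 + ∫ t in (1 : ℝ)..y, Mertens.mertensTau t * t⁻¹ := by
    rw [← intervalIntegral.integral_of_le hy, ← intervalIntegral.integral_neg]
    have heq : ∀ t : ℝ, -(-t⁻¹ * Mertens.primeLogDivSum t) =
        Real.log t * t⁻¹ + Mertens.mertensTau t * t⁻¹ := by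
      intro t
      rw [Mertens.mertensTau]
      ring
    simp_rw [heq]
    rw [intervalIntegral.integral_add hI1 hI2]
    congr 1
    have hFTC : ∫ t in (1 : ℝ)..y, Real.log t * t⁻¹ =
        Real.log y * Real.log y / 2 - Real.log 1 * Real.log 1 / 2 := by
      apply intervalIntegral.integral_eq_sub_of_hasDerivAt (f := fun t : ℝ ↦ Real.log t * Real.log t / 2)
      · intro t ht
        rw [uIcc_of_le hy] at ht
        have ht0 : t ≠ 0 := by linarith [ht.1]
        have h : HasDerivAt (fun u : ℝ ↦ Real.log u * Real.log u / 2)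
            ((t⁻¹ * Real.log t + Real.log t * t⁻¹) / 2) t :=
          ((Real.hasDerivAt_log ht0).fun_mul (Real.hasDerivAt_log ht0)).div_const 2
        exact h.congr_deriv (by ring)
      · exact hI1
    rw [hFTC, Real.log_one]
    ring
  rw [← hL, habel, hR]

/-- **`f₂(x) = ¼ log²x + O(log x)`**, explicitly: if `|a| ≤ 1` and `a(p²) = 1` for the primes `p ∤ N` (`N ≠ 0`), then
`|f₂(x) − ¼ log²x| ≤ (4 + 2 Σ_{p ∣ N} log p/p) log x` for `x ≥ 1`. [cite: Suzuki2025Chebyshev, §4.2 (proof of Thm 9, `f₂`)] -/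
theorem abs_fTwo_sub_le {N : ℕ} (hN : N ≠ 0) {a : ℕ → ℝ} (ha : ∀ n, |a n| ≤ 1)
    (ha1 : ∀ p : ℕ, p.Prime → ¬ p ∣ N → a (p ^ 2) = 1) {x : ℝ} (hx : 1 ≤ x) :
    |fTwo a x - Real.log x ^ 2 / 4| ≤ (4 + 2 * ∑ p ∈ N.primeFactors, Real.log p / p) * Real.log x := by
  have hx0 : 0 ≤ x := by linarith
  set y := Real.sqrt x with hydef
  have hy : 1 ≤ y := by rw [hydef, ← Real.sqrt_one]; exact Real.sqrt_le_sqrt hx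
  have hy0 : 0 < y := by linarith
  have hlogx : Real.log x = 2 * Real.log y := by rw [hydef, Real.log_sqrt hx0]; ring
  have hlogy : 0 ≤ Real.log y := Real.log_nonneg hy
  set P := (Finset.Icc 1 ⌊y⌋₊).filter Nat.Prime with hP
  set M : ℝ := ∑ p ∈ P, Real.log p / p * Real.log (y / p) with hM
  set E : ℝ := ∑ p ∈ P, (1 - a (p ^ 2)) * (Real.log p / p * Real.log (y / p)) with hE
  -- `f₂(x) = 2M − 2E`
  have hmem : ∀ p ∈ P, p.Prime ∧ (0 : ℝ) < p ∧ (p : ℝ) ≤ y := by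
    intro p hp
    rw [hP, Finset.mem_filter, Finset.mem_Icc] at hp
    exact ⟨hp.2, by exact_mod_cast hp.2.pos, le_trans (by exact_mod_cast hp.1.2) (Nat.floor_le hy0.le)⟩
  have hf2 : fTwo a x = 2 * M - 2 * E := by
    rw [hM, hE, Finset.mul_sum, Finset.mul_sum, ← Finset.sum_sub_distrib, fTwo]
    refine Finset.sum_congr rfl fun p hp ↦ ?_
    obtain ⟨-, hp0, -⟩ := hmem p hp
    have hlog : Real.log (x / (p : ℝ) ^ 2) = 2 * Real.log (y / p) := by
      rw [Real.log_div (by linarith) (by positivity), Real.log_div hy0.ne' hp0.ne', Real.log_pow, hlogx]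
      ring
    rw [hlog]
    ring
  -- the error term `E`: only the primes `p ∣ N` contribute
  have hEle : |E| ≤ (2 * ∑ p ∈ N.primeFactors, Real.log p / p) * Real.log y := by
    have hterm : ∀ p ∈ P, |(1 - a (p ^ 2)) * (Real.log p / p * Real.log (y / p))| ≤
        if p ∣ N then 2 * (Real.log p / p) * Real.log y else 0 := by
      intro p hp
      obtain ⟨hpr, hp0, hpy⟩ := hmem p hp
      by_cases hpN : p ∣ N
      · rw [if_pos hpN, abs_mul]
        have h1 : |1 - a (p ^ 2)| ≤ 2 := by
          have := ha (p ^ 2)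
          rw [abs_le] at this ⊢
          constructor <;> linarith [this.1, this.2]
        have hlp : 0 ≤ Real.log p / p := div_nonneg (Real.log_nonneg (by exact_mod_cast hpr.one_lt.le)) hp0.le
        have hl0 : 0 ≤ Real.log (y / p) := Real.log_nonneg ((one_le_div hp0).2 hpy)
        have hl1 : Real.log (y / p) ≤ Real.log y :=
          Real.log_le_log (div_pos hy0 hp0) (div_le_self hy0.le (by exact_mod_cast hpr.one_lt.le))
        rw [abs_of_nonneg (mul_nonneg hlp hl0)]
        calc |1 - a (p ^ 2)| * (Real.log p / p * Real.log (y / p)) ≤ 2 * (Real.log p / p * Real.log y) :=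
              mul_le_mul h1 (mul_le_mul_of_nonneg_left hl1 hlp) (mul_nonneg hlp hl0) (by norm_num)
          _ = 2 * (Real.log p / p) * Real.log y := by ring
      · rw [if_neg hpN, ha1 p hpr hpN, sub_self, zero_mul, abs_zero]
    calc |E| ≤ ∑ p ∈ P, |(1 - a (p ^ 2)) * (Real.log p / p * Real.log (y / p))| := Finset.abs_sum_le_sum_abs _ _
      _ ≤ ∑ p ∈ P, if p ∣ N then 2 * (Real.log p / p) * Real.log y else 0 := Finset.sum_le_sum hterm
      _ = ∑ p ∈ P.filter (· ∣ N), 2 * (Real.log p / p) * Real.log y := (Finset.sum_filter _ _).symm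
      _ ≤ ∑ p ∈ N.primeFactors, 2 * (Real.log p / p) * Real.log y := by
          apply Finset.sum_le_sum_of_subset_of_nonneg
          · intro p hp
            rw [Finset.mem_filter] at hp
            exact Nat.mem_primeFactors.2 ⟨(hmem p hp.1).1, hp.2, hN⟩
          · intro p hp _
            obtain ⟨hpr, -, -⟩ := Nat.mem_primeFactors.1 hp
            have hp0 : (0 : ℝ) < p := by exact_mod_cast hpr.pos
            have hlp : 0 ≤ Real.log p / p :=
              div_nonneg (Real.log_nonneg (by exact_mod_cast hpr.one_lt.le)) hp0.le
            positivity
      _ = (2 * ∑ p ∈ N.primeFactors, Real.log p / p) * Real.log y := by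
          rw [Finset.mul_sum, Finset.sum_mul]
  -- Mertens
  have hMeq := sum_log_div_mul_log_eq hy
  rw [← hP, ← hM] at hMeq
  have hI := abs_integral_mertensTau_le hy
  have hmain : fTwo a x - Real.log x ^ 2 / 4 =
      2 * (∫ t in (1 : ℝ)..y, Mertens.mertensTau t * t⁻¹) - 2 * E := by
    rw [hf2, hMeq, hlogx]; ring
  rw [hmain, hlogx]
  have hS0 : 0 ≤ ∑ p ∈ N.primeFactors, Real.log p / p := by
    refine Finset.sum_nonneg fun p hp ↦ ?_
    obtain ⟨hpr, -, -⟩ := Nat.mem_primeFactors.1 hp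
    exact div_nonneg (Real.log_nonneg (by exact_mod_cast hpr.one_lt.le)) (Nat.cast_nonneg _)
  calc |2 * (∫ t in (1 : ℝ)..y, Mertens.mertensTau t * t⁻¹) - 2 * E|
      ≤ |2 * (∫ t in (1 : ℝ)..y, Mertens.mertensTau t * t⁻¹)| + |2 * E| := abs_sub _ _
    _ = 2 * |∫ t in (1 : ℝ)..y, Mertens.mertensTau t * t⁻¹| + 2 * |E| := by
        rw [abs_mul, abs_mul, abs_of_pos (by norm_num : (0 : ℝ) < 2)]
    _ ≤ 2 * (4 * Real.log y) + 2 * ((2 * ∑ p ∈ N.primeFactors, Real.log p / p) * Real.log y) := by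
        gcongr
    _ = (4 + 2 * ∑ p ∈ N.primeFactors, Real.log p / p) * (2 * Real.log y) := by ring

/-! ## §4 Under GRH, `f_ψ(x) = O(log x)` for a primitive `ψ` (the real part of the tree's (4.5)) -/

variable {N : ℕ} [NeZero N]

omit [NeZero N] in
/-- The real part of the tree's complex `f_ψ(x)` (`HalfLineRiesz.halfLineSum`) is `f` with coefficients `Re ψ`.
[folklore] -/
private theorem re_halfLineSum (ψ : DirichletCharacter ℂ N) (x : ℝ) :
    (HalfLineRiesz.halfLineSum ψ x).re = fSum (fun n ↦ (ψ n).re) x := by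
  rw [HalfLineRiesz.halfLineSum, Complex.re_sum, fSum]
  refine Finset.sum_congr rfl fun n _ ↦ ?_
  rw [Complex.re_mul_ofReal, Complex.div_ofReal_re, Complex.re_ofReal_mul]

/-- **GRH ⟹ `|f_ψ(x)| ≤ B + ‖(L'/L)(½, ψ)‖ log x`** (`x > 1`) for a primitive `ψ` mod `N > 1` with `L(½, ψ) ≠ 0`:
the real part of `f_ψ(x) = −(L'/L)(½, ψ) log x + O(1)` (Suzuki (4.5) under GRH, the tree's
`HalfLineRiesz.exists_norm_halfLineSum_add_le_of_GRH`). GRH-CONDITIONAL. [cite: Suzuki2025Chebyshev, §4.1 (4.5)] -/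
theorem exists_abs_fSum_le (ψ : DirichletCharacter ℂ N) (hprim : ψ.IsPrimitive) (hN : 1 < N)
    (hhalf : ψ.LFunction (1 / 2) ≠ 0) (hGRH : ψ.RiemannHypothesis) :
    ∃ B D : ℝ, 0 ≤ D ∧ ∀ x : ℝ, 1 < x → |fSum (fun n ↦ (ψ n).re) x| ≤ B + D * Real.log x := by
  obtain ⟨B, hB⟩ := HalfLineRiesz.exists_norm_halfLineSum_add_le_of_GRH hprim hN hhalf hGRH
  set Dc : ℂ := deriv ψ.LFunction (1 / 2) / ψ.LFunction (1 / 2) with hDc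
  refine ⟨B, ‖Dc‖, norm_nonneg _, fun x hx ↦ ?_⟩
  have hlx : 0 ≤ Real.log x := (Real.log_pos hx).le
  rw [← re_halfLineSum]
  calc |(HalfLineRiesz.halfLineSum ψ x).re| ≤ ‖HalfLineRiesz.halfLineSum ψ x‖ := Complex.abs_re_le_norm _
    _ = ‖(HalfLineRiesz.halfLineSum ψ x + (Real.log x : ℂ) * Dc) - (Real.log x : ℂ) * Dc‖ := by
        rw [add_sub_cancel_right]
    _ ≤ ‖HalfLineRiesz.halfLineSum ψ x + (Real.log x : ℂ) * Dc‖ + ‖(Real.log x : ℂ) * Dc‖ := norm_sub_le _ _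
    _ ≤ B + ‖Dc‖ * Real.log x := by
        gcongr
        · exact hB x hx
        · rw [norm_mul, Complex.norm_real, Real.norm_eq_abs, abs_of_nonneg hlx, mul_comm]

/-! ## §5 The printed conclusion for a primitive real character -/

omit [NeZero N] in
/-- The values of a real character at the primes `p ∤ N` are `±1`, so `Re ψ(p²) = (Re ψ(p))² = 1`. [folklore] -/
private theorem re_map_prime_sq (ψ : DirichletCharacter ℂ N) (hreal : ∀ a : ZMod N, (ψ a).im = 0)
    {p : ℕ} (hp : p.Prime) (hpN : ¬ p ∣ N) : (ψ ((p ^ 2 : ℕ) : ZMod N)).re = 1 := by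
  have hu : IsUnit ((p : ℕ) : ZMod N) := (ZMod.isUnit_prime_iff_not_dvd hp).2 hpN
  obtain ⟨u, hu'⟩ := hu
  have hnorm : ‖ψ (p : ZMod N)‖ = 1 := by rw [← hu']; exact ψ.unit_norm_eq_one u
  have him : (ψ (p : ZMod N)).im = 0 := hreal _
  have hre2 : (ψ (p : ZMod N)).re ^ 2 = 1 := by
    have h := Complex.sq_norm (ψ (p : ZMod N))
    rw [hnorm, Complex.normSq_apply, him, mul_zero, add_zero, one_pow] at h
    rw [sq]; exact h.symm
  rw [Nat.cast_pow, map_pow, sq, Complex.mul_re, him, mul_zero, sub_zero, ← sq, hre2]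

/-- **Suzuki 2025, Thm 9, (4.8), PROVED for primitive real characters**: for a primitive real `ψ` mod `N > 1` with
`L(½, ψ) ≠ 0`, the GRH for `L(s, ψ)` gives `|Σ_{p ≤ x} ψ(p) log p √(x/p) log(x/p) + (√x/4) log²x| ≤ K √x log x` for
`x ≥ 2`. GRH-CONDITIONAL. [cite: Suzuki2025Chebyshev, §4.2 Thm 9 (second half, (4.8))] -/
theorem exists_abs_primeSum_add_le (ψ : DirichletCharacter ℂ N) (hprim : ψ.IsPrimitive) (hN : 1 < N)
    (hreal : ∀ a : ZMod N, (ψ a).im = 0) (hhalf : ψ.LFunction (1 / 2) ≠ 0) (hGRH : ψ.RiemannHypothesis) :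
    ∃ K : ℝ, ∀ x : ℝ, 2 ≤ x →
      |Real.sqrt x * fOne (fun n ↦ (ψ n).re) x + Real.sqrt x / 4 * Real.log x ^ 2| ≤
        K * (Real.sqrt x * Real.log x) := by
  set a : ℕ → ℝ := fun n ↦ (ψ n).re with hadef
  have ha : ∀ n, |a n| ≤ 1 := fun n ↦ le_trans (Complex.abs_re_le_norm _) (ψ.norm_le_one _)
  have ha1 : ∀ p : ℕ, p.Prime → ¬ p ∣ N → a (p ^ 2) = 1 := fun p hp hpN ↦ re_map_prime_sq ψ hreal hp hpN
  have hN0 : N ≠ 0 := by omega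
  obtain ⟨B, D, hD, hBD⟩ := exists_abs_fSum_le ψ hprim hN hhalf hGRH
  set C₂ : ℝ := 4 + 2 * ∑ p ∈ N.primeFactors, Real.log p / p with hC₂
  set C₃ : ℝ := 4 * ∑' n, w n with hC₃
  have hlog2 : 0 < Real.log 2 := Real.log_pos (by norm_num)
  refine ⟨|B| / Real.log 2 + D + C₃ + C₂, fun x hx ↦ ?_⟩
  have hx1 : 1 ≤ x := by linarith
  have hsx : 0 ≤ Real.sqrt x := Real.sqrt_nonneg x
  have hlx : Real.log 2 ≤ Real.log x := Real.log_le_log (by norm_num) hx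
  have hlx0 : 0 ≤ Real.log x := le_trans hlog2.le hlx
  have h1 := hBD x (by linarith)
  have h2 := abs_fTwo_sub_le hN0 ha ha1 hx1
  have h3 := abs_fThree_le ha hx1
  rw [← hC₂] at h2
  rw [← hC₃] at h3
  have hsplit : Real.sqrt x * fOne a x + Real.sqrt x / 4 * Real.log x ^ 2 =
      Real.sqrt x * (fSum a x - fThree a x - (fTwo a x - Real.log x ^ 2 / 4)) := by
    rw [fSum_eq a (by linarith)]; ring
  rw [hsplit, abs_mul, abs_of_nonneg hsx, mul_comm (|B| / Real.log 2 + D + C₃ + C₂), mul_assoc]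
  refine mul_le_mul_of_nonneg_left ?_ hsx
  have hB' : B ≤ |B| / Real.log 2 * Real.log x := by
    calc B ≤ |B| := le_abs_self B
      _ = |B| / Real.log 2 * Real.log 2 := by field_simp
      _ ≤ |B| / Real.log 2 * Real.log x :=
          mul_le_mul_of_nonneg_left hlx (div_nonneg (abs_nonneg _) hlog2.le)
  calc |fSum a x - fThree a x - (fTwo a x - Real.log x ^ 2 / 4)|
      ≤ |fSum a x - fThree a x| + |fTwo a x - Real.log x ^ 2 / 4| := abs_sub _ _
    _ ≤ |fSum a x| + |fThree a x| + |fTwo a x - Real.log x ^ 2 / 4| := by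
        gcongr; exact abs_sub _ _
    _ ≤ (B + D * Real.log x) + C₃ * Real.log x + C₂ * Real.log x := by gcongr
    _ ≤ (|B| / Real.log 2 * Real.log x + D * Real.log x) + C₃ * Real.log x + C₂ * Real.log x := by
        gcongr
    _ = Real.log x * (|B| / Real.log 2 + D + C₃ + C₂) := by ring

/-! ## §6 The general real non-principal character: passage to the inducing primitive character -/

/-- The inducing primitive character of a real character is real (the units map `(ℤ/q)ˣ → (ℤ/N)ˣ` is onto).
[folklore] -/
private theorem primitiveCharacter_real {q : ℕ} [NeZero q] (χ : DirichletCharacter ℂ q)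
    (hreal : ∀ a : ZMod q, (χ a).im = 0) :
    haveI : NeZero χ.conductor := ⟨χ.conductor_ne_zero⟩
    ∀ a : ZMod χ.conductor, (χ.primitiveCharacter a).im = 0 := by
  haveI : NeZero χ.conductor := ⟨χ.conductor_ne_zero⟩
  intro a
  by_cases ha : IsUnit a
  · obtain ⟨u, rfl⟩ := ha
    obtain ⟨v, hv⟩ := ZMod.unitsMap_surjective χ.conductor_dvd_level u
    have h1 : χ (v : ZMod q) = χ.primitiveCharacter (u : ZMod χ.conductor) := by
      conv_lhs => rw [← DirichletCharacter.changeLevel_primitiveCharacter χ]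
      rw [DirichletCharacter.changeLevel_eq_cast_of_dvd, ← hv, ZMod.unitsMap_def, Units.coe_map]
      rfl
    rw [← h1]
    exact hreal _
  · rw [MulChar.map_nonunit _ ha, Complex.zero_im]

/-- At a prime `p ∤ q`, `χ(p) = χ⋆(p)`; at a prime `p ∣ q`, `χ(p) = 0`. [folklore] -/
private theorem map_prime_eq {q : ℕ} [NeZero q] (χ : DirichletCharacter ℂ q) {p : ℕ} (hp : p.Prime) :
    haveI : NeZero χ.conductor := ⟨χ.conductor_ne_zero⟩
    χ (p : ZMod q) = if p ∣ q then 0 else χ.primitiveCharacter (p : ZMod χ.conductor) := by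
  haveI : NeZero χ.conductor := ⟨χ.conductor_ne_zero⟩
  by_cases hpq : p ∣ q
  · rw [if_pos hpq]
    exact MulChar.map_nonunit _ ((ZMod.isUnit_prime_iff_not_dvd hp).not.2 (not_not.2 hpq))
  · rw [if_neg hpq]
    obtain ⟨u, hu⟩ := (ZMod.isUnit_prime_iff_not_dvd hp).2 hpq
    conv_lhs => rw [← DirichletCharacter.changeLevel_primitiveCharacter χ, ← hu]
    rw [DirichletCharacter.changeLevel_eq_cast_of_dvd, hu, ZMod.cast_natCast χ.conductor_dvd_level]

/-- **Discharge of `Suzuki2025Chebyshev_thm9_asymp`** (Suzuki 2025, Thm 9, second half, (4.8), AS TYPED): for every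
real non-principal `χ` mod `q` with `L(½, χ) ≠ 0`, the GRH for `L(s, χ)` implies
`Σ_{p ≤ x} χ(p) log p √(x/p) log(x/p) + (√x/4) log²x = O(√x log x)`. Via the inducing primitive character `χ⋆`
(`exists_abs_primeSum_add_le`), the two prime sums differing only at the primes `p ∣ q`. GRH-CONDITIONAL asymptotic
inside a GRH-EQUIVALENT criterion; nothing here bears on the truth of RH.
[cite: Suzuki2025Chebyshev, §4.2 Thm 9 (second half, (4.8))] -/
theorem Suzuki2025Chebyshev_thm9_asymp_holds : Suzuki2025Chebyshev_thm9_asymp := by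
  intro q _ χ hχ hreal hGRH hhalf
  haveI : NeZero χ.conductor := ⟨χ.conductor_ne_zero⟩
  have hN1 : 1 < χ.conductor := by
    have h1 : χ.conductor ≠ 1 := fun h ↦ hχ (DirichletCharacter.eq_one_iff_conductor_eq_one.2 h)
    have h0 : χ.conductor ≠ 0 := χ.conductor_ne_zero
    omega
  set ψ := χ.primitiveCharacter with hψdef
  have hprim : ψ.IsPrimitive := DirichletCharacter.primitiveCharacter_isPrimitive χ
  have hψGRH : ψ.RiemannHypothesis :=
    (DirichletCharacter.riemannHypothesis_iff_primitiveCharacter_holds χ).1 hGRH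
  have hψhalf : ψ.LFunction (1 / 2) ≠ 0 := fun h ↦
    hhalf ((χ.LFunction_eq_zero_iff_primitiveCharacter (s := 1 / 2) (by norm_num) (by norm_num)).2 h)
  have hψreal : ∀ a : ZMod χ.conductor, (ψ a).im = 0 := primitiveCharacter_real χ hreal
  obtain ⟨K, hK⟩ := exists_abs_primeSum_add_le ψ hprim hN1 hψreal hψhalf hψGRH
  set aχ : ℕ → ℝ := fun n ↦ (χ n).re with haχ
  set aψ : ℕ → ℝ := fun n ↦ (ψ n).re with haψ
  set cq : ℝ := ∑ p ∈ q.primeFactors, Real.log p with hcq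
  have hq0 : q ≠ 0 := NeZero.ne q
  -- `f₁` for `χ` and for `ψ` differ by at most `(Σ_{p ∣ q} log p) log x`
  have hdiff : ∀ x : ℝ, 1 ≤ x → |fOne aχ x - fOne aψ x| ≤ cq * Real.log x := by
    intro x hx
    have hx0 : 0 < x := by linarith
    rw [fOne, fOne, ← Finset.sum_sub_distrib]
    have hterm : ∀ p ∈ (Finset.Icc 1 ⌊x⌋₊).filter Nat.Prime,
        |aχ p * Real.log p / Real.sqrt p * Real.log (x / p) - aψ p * Real.log p / Real.sqrt p * Real.log (x / p)|
          ≤ if p ∣ q then Real.log p * Real.log x else 0 := by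
      intro p hp
      rw [Finset.mem_filter, Finset.mem_Icc] at hp
      have hpr := hp.2
      have hp0 : (0 : ℝ) < p := by exact_mod_cast hpr.pos
      have hp1 : (1 : ℝ) ≤ p := by exact_mod_cast hpr.one_lt.le
      have hpx : (p : ℝ) ≤ x := le_trans (by exact_mod_cast hp.1.2) (Nat.floor_le hx0.le)
      have hval := map_prime_eq χ hpr
      by_cases hpq : p ∣ q
      · rw [if_pos hpq]
        rw [if_pos hpq] at hval
        have h0 : aχ p = 0 := by rw [haχ]; simp only [hval, Complex.zero_re]
        rw [h0, zero_mul, zero_div, zero_mul, zero_sub, abs_neg, abs_mul, abs_div, abs_mul,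
          abs_of_nonneg (Real.log_nonneg hp1), abs_of_nonneg (Real.sqrt_nonneg _),
          abs_of_nonneg (Real.log_nonneg ((one_le_div hp0).2 hpx))]
        have h1 : |aψ p| ≤ 1 := le_trans (Complex.abs_re_le_norm _) (ψ.norm_le_one _)
        have hsq1 : 1 ≤ Real.sqrt p := by rw [← Real.sqrt_one]; exact Real.sqrt_le_sqrt hp1
        have hl1 : Real.log (x / p) ≤ Real.log x :=
          Real.log_le_log (div_pos hx0 hp0) (div_le_self hx0.le hp1)
        calc |aψ p| * Real.log p / Real.sqrt p * Real.log (x / p)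
            ≤ 1 * Real.log p / 1 * Real.log x := by
              apply mul_le_mul _ hl1 (Real.log_nonneg ((one_le_div hp0).2 hpx)) (by positivity)
              rw [mul_div_assoc, mul_div_assoc]
              exact mul_le_mul h1 (div_le_div_of_nonneg_left (Real.log_nonneg hp1) one_pos hsq1)
                (div_nonneg (Real.log_nonneg hp1) (Real.sqrt_nonneg _)) zero_le_one
          _ = Real.log p * Real.log x := by ring
      · rw [if_neg hpq]
        rw [if_neg hpq, ← hψdef] at hval
        have h0 : aχ p = aψ p := by simp only [haχ, haψ, hval]
        rw [h0, sub_self, abs_zero]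
    calc |∑ p ∈ (Finset.Icc 1 ⌊x⌋₊).filter Nat.Prime,
          (aχ p * Real.log p / Real.sqrt p * Real.log (x / p) - aψ p * Real.log p / Real.sqrt p * Real.log (x / p))|
        ≤ ∑ p ∈ (Finset.Icc 1 ⌊x⌋₊).filter Nat.Prime,
          |aχ p * Real.log p / Real.sqrt p * Real.log (x / p) - aψ p * Real.log p / Real.sqrt p * Real.log (x / p)| :=
          Finset.abs_sum_le_sum_abs _ _
      _ ≤ ∑ p ∈ (Finset.Icc 1 ⌊x⌋₊).filter Nat.Prime, if p ∣ q then Real.log p * Real.log x else 0 :=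
          Finset.sum_le_sum hterm
      _ = ∑ p ∈ ((Finset.Icc 1 ⌊x⌋₊).filter Nat.Prime).filter (· ∣ q), Real.log p * Real.log x :=
          (Finset.sum_filter _ _).symm
      _ ≤ ∑ p ∈ q.primeFactors, Real.log p * Real.log x := by
          apply Finset.sum_le_sum_of_subset_of_nonneg
          · intro p hp
            rw [Finset.mem_filter, Finset.mem_filter] at hp
            exact Nat.mem_primeFactors.2 ⟨hp.1.2, hp.2, hq0⟩
          · intro p hp _
            obtain ⟨hpr, -, -⟩ := Nat.mem_primeFactors.1 hp
            exact mul_nonneg (Real.log_nonneg (by exact_mod_cast hpr.one_lt.le)) (Real.log_nonneg hx)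
      _ = cq * Real.log x := by rw [hcq, Finset.sum_mul]
  -- assembly
  refine Asymptotics.IsBigO.of_bound (K + cq) ?_
  filter_upwards [eventually_ge_atTop (2 : ℝ)] with x hx
  have hx1 : 1 ≤ x := by linarith
  have hx0 : 0 ≤ x := by linarith
  have hsx : 0 ≤ Real.sqrt x := Real.sqrt_nonneg x
  have hlx : 0 ≤ Real.log x := Real.log_nonneg hx1
  have hsum : ∑ p ∈ (Finset.Icc 1 ⌊x⌋₊).filter Nat.Prime,
      (χ (p : ZMod q)).re * Real.log p * Real.sqrt (x / p) * Real.log (x / p) = Real.sqrt x * fOne aχ x := by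
    rw [fOne, Finset.mul_sum]
    refine Finset.sum_congr rfl fun p _ ↦ ?_
    rw [haχ, Real.sqrt_div hx0]
    ring
  rw [Real.norm_eq_abs, Real.norm_eq_abs, abs_of_nonneg (mul_nonneg hsx hlx), hsum,
    show Real.sqrt x * fOne aχ x + Real.sqrt x / 4 * Real.log x ^ 2 =
      (Real.sqrt x * fOne aψ x + Real.sqrt x / 4 * Real.log x ^ 2) + Real.sqrt x * (fOne aχ x - fOne aψ x) by ring]
  calc |Real.sqrt x * fOne aψ x + Real.sqrt x / 4 * Real.log x ^ 2 + Real.sqrt x * (fOne aχ x - fOne aψ x)|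
      ≤ |Real.sqrt x * fOne aψ x + Real.sqrt x / 4 * Real.log x ^ 2| + |Real.sqrt x * (fOne aχ x - fOne aψ x)| :=
        abs_add_le _ _
    _ ≤ K * (Real.sqrt x * Real.log x) + Real.sqrt x * (cq * Real.log x) := by
        gcongr
        · exact hK x hx
        · rw [abs_mul, abs_of_nonneg hsx]
          exact mul_le_mul_of_nonneg_left (hdiff x hx1) hsx
    _ = (K + cq) * (Real.sqrt x * Real.log x) := by ring

end SuzukiThm9

end Literature.NumberTheory.LFunctions

end
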